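import Mathlib

/-!
# Centred-form (second-order Taylor) SOUNDNESS lemmas for box certificates of lattice-sum floors

Def-free, generic real analysis serving the Lean endgame of the `HomFloor m` certifier of the 27623 T-side line
(`…StrainedPatchHomSplit` / `…StrainedPatchHomLattice`: `homFloor_of_latticeSums` reduces (H) to inequalities
`m ≤ ½ ∑ᶠ v, W ‖G v‖ − e` over boxes of Gram matrices; design memo decomp-a2c lens-5 g44 CERT-DESIGN-g44 §1–2 (P4), §5 (L1)/(L2)).

A leaf of such a certificate asserts `m ≤ x c` for every `c` in a box `∏ᵢ [c₀ᵢ − wᵢ, c₀ᵢ + wᵢ]`, where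
`x c = ∑_{v ∈ S} φᵥ (ℓᵥ c)` and every `ℓᵥ` is LINEAR in `c` (squared lattice lengths are linear in the Gram coordinates).
The checker evaluates `x c₀`, the gradient `gᵢ = ∑ᵥ φᵥ′(ℓᵥ c₀) Lᵥᵢ`, and per-term curvature constants `Mᵥ` with `φᵥ′ + Mᵥ·id`
monotone on the term's range, and accepts the leaf iff `m ≤ x c₀ − ∑ᵢ |gᵢ| wᵢ − ½ ∑ᵥ Mᵥ (∑ᵢ |Lᵥᵢ| wᵢ)²`.
This file proves that acceptance is SOUND:
* `tangent_parabola_le` — 1-D: `φ′ + M·id` monotone on `[a,b] ∋ q₀` ⟹ `φ q₀ + φ′ q₀ (q − q₀) − M/2 (q − q₀)² ≤ φ q` on `[a,b]`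
  (and the mirror `le_tangent_parabola` for upper bounds); `monotoneOn_deriv_add_mul_of_le_deriv2` — the usual way to get the
  monotonicity from a second-derivative bound `−M ≤ φ″`;
* `centredForm_le_sum` — the many-term, many-variable centred form on a box;
* `leaf_sound` — the acceptance inequality implies `m ≤ x c` on the box; `leaf_sound_box` — the same with the term ranges
  taken to be the explicit box ranges `ℓᵥ c₀ ∓ ∑ᵢ |Lᵥᵢ| wᵢ` (`linear_mem_Icc_of_box`), i.e. hypotheses on `φᵥ` and the checker's inequality only.
No definitions; standard axioms.  decomp-a2c hand-1 g19 (in-lane (S) support for stmt-AtomisticToContinuum-27623).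
-/

namespace Summit.AtomisticToContinuum.Crystallization.Theorems.FrustratedLawDichotomyStrainedPatchHomCentredForm

open Set Finset

/-! ## §1. One variable: the tangent parabola -/

/-- **Tangent-parabola LOWER bound.** If `φ` has derivative `φ′` on `[a,b]` and `q ↦ φ′ q + M·q` is monotone on `[a,b]`
(e.g. `φ″ ≥ −M`), then for `q₀, q ∈ [a,b]`: `φ q₀ + φ′ q₀·(q − q₀) − (M/2)·(q − q₀)² ≤ φ q`. [folklore: Taylor with a one-sided curvature bound] -/
theorem tangent_parabola_le {φ φ' : ℝ → ℝ} {a b q₀ M q : ℝ} (hq₀ : q₀ ∈ Icc a b) (hq : q ∈ Icc a b)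
    (hd : ∀ t ∈ Icc a b, HasDerivAt φ (φ' t) t) (hmono : MonotoneOn (fun t => φ' t + M * t) (Icc a b)) :
    φ q₀ + φ' q₀ * (q - q₀) - M / 2 * (q - q₀) ^ 2 ≤ φ q := by
  -- the defect `g` and its derivative `g'`
  set g : ℝ → ℝ := fun t => φ t - φ q₀ - φ' q₀ * (t - q₀) + M / 2 * (t - q₀) ^ 2 with hg
  set g' : ℝ → ℝ := fun t => (φ' t + M * t) - (φ' q₀ + M * q₀) with hg'
  have hgd : ∀ t ∈ Icc a b, HasDerivAt g (g' t) t := by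
    intro t ht
    have h1 : HasDerivAt (fun t => φ t - φ q₀ - φ' q₀ * (t - q₀) + M / 2 * (t - q₀) ^ 2)
        (φ' t - 0 - φ' q₀ * (1 - 0) + M / 2 * (2 * (t - q₀) ^ 1 * (1 - 0))) t := by
      have hp : HasDerivAt (fun t => (t - q₀) ^ 2) (2 * (t - q₀) ^ 1 * (1 - 0)) t :=
        ((hasDerivAt_id t).sub (hasDerivAt_const t q₀)).pow 2
      exact (((hd t ht).sub (hasDerivAt_const t (φ q₀))).sub
        (((hasDerivAt_id t).sub (hasDerivAt_const t q₀)).const_mul (φ' q₀))).add (hp.const_mul (M / 2))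
    have h2 : φ' t - 0 - φ' q₀ * (1 - 0) + M / 2 * (2 * (t - q₀) ^ 1 * (1 - 0)) = g' t := by
      simp only [hg']; ring
    rw [← h2]; exact h1
  have hg0 : g q₀ = 0 := by simp [hg]
  -- it suffices to show `0 ≤ g q`
  suffices h : 0 ≤ g q by
    have : g q = φ q - (φ q₀ + φ' q₀ * (q - q₀) - M / 2 * (q - q₀) ^ 2) := by simp only [hg]; ring
    linarith [this]
  rcases le_total q₀ q with hle | hle
  · -- on `[q₀, q]` the derivative `g'` is `≥ 0`, so `g` is monotone
    have hsub : Icc q₀ q ⊆ Icc a b := Icc_subset_Icc hq₀.1 hq.2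
    have hmon : MonotoneOn g (Icc q₀ q) := by
      refine monotoneOn_of_hasDerivWithinAt_nonneg (f' := g') (convex_Icc q₀ q)
        (HasDerivAt.continuousOn fun t ht => hgd t (hsub ht)) (fun t ht => ?_) (fun t ht => ?_)
      · exact (hgd t (hsub (interior_subset ht))).hasDerivWithinAt
      · have ht' : t ∈ Icc q₀ q := interior_subset ht
        have := hmono (hsub (left_mem_Icc.2 hle)) (hsub ht') ht'.1
        simp only [hg']; linarith
    have := hmon (left_mem_Icc.2 hle) (right_mem_Icc.2 hle) hle
    rwa [hg0] at this
  · -- on `[q, q₀]` the derivative `g'` is `≤ 0`, so `g` is antitone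
    have hsub : Icc q q₀ ⊆ Icc a b := Icc_subset_Icc hq.1 hq₀.2
    have hant : AntitoneOn g (Icc q q₀) := by
      refine antitoneOn_of_hasDerivWithinAt_nonpos (f' := g') (convex_Icc q q₀)
        (HasDerivAt.continuousOn fun t ht => hgd t (hsub ht)) (fun t ht => ?_) (fun t ht => ?_)
      · exact (hgd t (hsub (interior_subset ht))).hasDerivWithinAt
      · have ht' : t ∈ Icc q q₀ := interior_subset ht
        have := hmono (hsub ht') (hsub (right_mem_Icc.2 hle)) ht'.2
        simp only [hg']; linarith
    have := hant (left_mem_Icc.2 hle) (right_mem_Icc.2 hle) hle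
    rwa [hg0] at this

/-- **Tangent-parabola UPPER bound** (mirror image): `φ′ − M·id` antitone on `[a,b]` (e.g. `φ″ ≤ M`) ⟹
`φ q ≤ φ q₀ + φ′ q₀·(q − q₀) + (M/2)·(q − q₀)²`. [folklore] -/
theorem le_tangent_parabola {φ φ' : ℝ → ℝ} {a b q₀ M q : ℝ} (hq₀ : q₀ ∈ Icc a b) (hq : q ∈ Icc a b)
    (hd : ∀ t ∈ Icc a b, HasDerivAt φ (φ' t) t) (hanti : AntitoneOn (fun t => φ' t - M * t) (Icc a b)) :
    φ q ≤ φ q₀ + φ' q₀ * (q - q₀) + M / 2 * (q - q₀) ^ 2 := by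
  have hd' : ∀ t ∈ Icc a b, HasDerivAt (fun t => -φ t) ((fun t => -φ' t) t) t := fun t ht => (hd t ht).neg
  have hmono : MonotoneOn (fun t => (fun t => -φ' t) t + M * t) (Icc a b) := by
    intro s hs t ht hst
    have h1 : φ' t - M * t ≤ φ' s - M * s := hanti hs ht hst
    show -φ' s + M * s ≤ -φ' t + M * t
    linarith
  have h2 : -φ q₀ + -φ' q₀ * (q - q₀) - M / 2 * (q - q₀) ^ 2 ≤ -φ q := tangent_parabola_le hq₀ hq hd' hmono
  linarith

/-- From a second-derivative LOWER bound to the monotonicity hypothesis of `tangent_parabola_le`: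
if `φ′` has derivative `φ″ t ≥ −M` at every `t ∈ [a,b]`, then `φ′ + M·id` is monotone on `[a,b]`. [folklore] -/
theorem monotoneOn_deriv_add_mul_of_le_deriv2 {φ' φ'' : ℝ → ℝ} {a b M : ℝ}
    (hd : ∀ t ∈ Icc a b, HasDerivAt φ' (φ'' t) t) (hM : ∀ t ∈ Icc a b, -M ≤ φ'' t) :
    MonotoneOn (fun t => φ' t + M * t) (Icc a b) := by
  have hgd : ∀ t ∈ Icc a b, HasDerivAt (fun t => φ' t + M * t) (φ'' t + M * 1) t := fun t ht =>
    (hd t ht).add ((hasDerivAt_id' t).const_mul M)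
  refine monotoneOn_of_hasDerivWithinAt_nonneg (f' := fun t => φ'' t + M * 1) (convex_Icc a b)
    (HasDerivAt.continuousOn hgd) (fun t ht => (hgd t (interior_subset ht)).hasDerivWithinAt) fun t ht => ?_
  have := hM t (interior_subset ht)
  show 0 ≤ φ'' t + M * 1
  linarith

/-- Mirror: `φ″ ≤ M` on `[a,b]` ⟹ `φ′ − M·id` antitone on `[a,b]`. [folklore] -/
theorem antitoneOn_deriv_sub_mul_of_deriv2_le {φ' φ'' : ℝ → ℝ} {a b M : ℝ}
    (hd : ∀ t ∈ Icc a b, HasDerivAt φ' (φ'' t) t) (hM : ∀ t ∈ Icc a b, φ'' t ≤ M) :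
    AntitoneOn (fun t => φ' t - M * t) (Icc a b) := by
  have hgd : ∀ t ∈ Icc a b, HasDerivAt (fun t => φ' t - M * t) (φ'' t - M * 1) t := fun t ht =>
    (hd t ht).sub ((hasDerivAt_id' t).const_mul M)
  refine antitoneOn_of_hasDerivWithinAt_nonpos (f' := fun t => φ'' t - M * 1) (convex_Icc a b)
    (HasDerivAt.continuousOn hgd) (fun t ht => (hgd t (interior_subset ht)).hasDerivWithinAt) fun t ht => ?_
  have := hM t (interior_subset ht)
  show φ'' t - M * 1 ≤ 0
  linarith

/-! ## §2. Boxes and linear functionals -/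

/-- On a box `|cᵢ − c₀ᵢ| ≤ wᵢ`, a linear functional deviates from its centre value by at most `∑ᵢ |Lᵢ|·wᵢ`. [folklore] -/
theorem abs_linear_sub_le {n : ℕ} (L c c₀ w : Fin n → ℝ) (hbox : ∀ i, |c i - c₀ i| ≤ w i) :
    |∑ i, L i * c i - ∑ i, L i * c₀ i| ≤ ∑ i, |L i| * w i := by
  rw [← Finset.sum_sub_distrib]
  calc |∑ i, (L i * c i - L i * c₀ i)| ≤ ∑ i, |L i * c i - L i * c₀ i| := abs_sum_le_sum_abs _ _
    _ = ∑ i, |L i| * |c i - c₀ i| := by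
        refine Finset.sum_congr rfl fun i _ => ?_
        rw [← mul_sub, abs_mul]
    _ ≤ ∑ i, |L i| * w i := Finset.sum_le_sum fun i _ => mul_le_mul_of_nonneg_left (hbox i) (abs_nonneg _)

/-- The linear part of the centred form on a box: `∑ᵢ gᵢ (cᵢ − c₀ᵢ) ≥ −∑ᵢ |gᵢ| wᵢ`. [folklore] -/
theorem neg_sum_abs_mul_le_linear {n : ℕ} (g c c₀ w : Fin n → ℝ) (hbox : ∀ i, |c i - c₀ i| ≤ w i) :
    -∑ i, |g i| * w i ≤ ∑ i, g i * (c i - c₀ i) := by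
  have h1 : |∑ i, g i * (c i - c₀ i)| ≤ ∑ i, |g i| * w i := by
    calc |∑ i, g i * (c i - c₀ i)| ≤ ∑ i, |g i * (c i - c₀ i)| := abs_sum_le_sum_abs _ _
      _ ≤ ∑ i, |g i| * w i := Finset.sum_le_sum fun i _ => by
          rw [abs_mul]; exact mul_le_mul_of_nonneg_left (hbox i) (abs_nonneg _)
  have := neg_abs_le (∑ i, g i * (c i - c₀ i))
  linarith

/-! ## §3. The centred form for a sum of univariate terms of linear functionals -/

/-- **Centred form, term-wise.**  `x c = ∑_{v ∈ S} φᵥ (ℓᵥ c)` with `ℓᵥ c = ∑ᵢ Lᵥᵢ cᵢ`; if on the box every `ℓᵥ` stays in a range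
`[aᵥ, bᵥ]` on which `φᵥ` has derivative `φᵥ′` with `φᵥ′ + Mᵥ·id` monotone, then for every `c` in the box
`∑ᵥ (φᵥ(ℓᵥ c₀) + φᵥ′(ℓᵥ c₀)(ℓᵥ c − ℓᵥ c₀) − Mᵥ/2 (ℓᵥ c − ℓᵥ c₀)²) ≤ x c`. [folklore] -/
theorem centredForm_le_sum {ι : Type*} (S : Finset ι) {n : ℕ} (L : ι → Fin n → ℝ) (φ φ' : ι → ℝ → ℝ)
    (lo hi M : ι → ℝ) (c c₀ : Fin n → ℝ)
    (hr₀ : ∀ v ∈ S, ∑ i, L v i * c₀ i ∈ Icc (lo v) (hi v)) (hr : ∀ v ∈ S, ∑ i, L v i * c i ∈ Icc (lo v) (hi v))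
    (hd : ∀ v ∈ S, ∀ t ∈ Icc (lo v) (hi v), HasDerivAt (φ v) (φ' v t) t)
    (hmono : ∀ v ∈ S, MonotoneOn (fun t => φ' v t + M v * t) (Icc (lo v) (hi v))) :
    ∑ v ∈ S, (φ v (∑ i, L v i * c₀ i) + φ' v (∑ i, L v i * c₀ i) * (∑ i, L v i * c i - ∑ i, L v i * c₀ i)
        - M v / 2 * (∑ i, L v i * c i - ∑ i, L v i * c₀ i) ^ 2) ≤ ∑ v ∈ S, φ v (∑ i, L v i * c i) :=
  Finset.sum_le_sum fun v hv => tangent_parabola_le (hr₀ v hv) (hr v hv) (hd v hv) (hmono v hv)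

/-- **LEAF SOUNDNESS.**  With `x c = ∑_{v∈S} φᵥ(∑ᵢ Lᵥᵢ cᵢ)`, gradient `gᵢ = ∑ᵥ φᵥ′(ℓᵥ c₀)·Lᵥᵢ`, non-negative curvature constants `Mᵥ`
(`φᵥ′ + Mᵥ·id` monotone on `[loᵥ, hiᵥ] ⊇ ℓᵥ(box)`), and half-widths `wᵢ`: if the checker's inequality
`m ≤ x c₀ − ∑ᵢ |gᵢ| wᵢ − ½ ∑ᵥ Mᵥ (∑ᵢ |Lᵥᵢ| wᵢ)²` holds, then `m ≤ x c` for every `c` with `|cᵢ − c₀ᵢ| ≤ wᵢ`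
(provided the box ranges `ℓᵥ c ∈ [loᵥ, hiᵥ]` are certified, e.g. by `abs_linear_sub_le`). [folklore] -/
theorem leaf_sound {ι : Type*} (S : Finset ι) {n : ℕ} (L : ι → Fin n → ℝ) (φ φ' : ι → ℝ → ℝ)
    (lo hi M : ι → ℝ) (c₀ w : Fin n → ℝ) (m : ℝ) (hM : ∀ v ∈ S, 0 ≤ M v)
    (hd : ∀ v ∈ S, ∀ t ∈ Icc (lo v) (hi v), HasDerivAt (φ v) (φ' v t) t)
    (hmono : ∀ v ∈ S, MonotoneOn (fun t => φ' v t + M v * t) (Icc (lo v) (hi v)))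
    (hr₀ : ∀ v ∈ S, ∑ i, L v i * c₀ i ∈ Icc (lo v) (hi v))
    (hrange : ∀ v ∈ S, ∀ c : Fin n → ℝ, (∀ i, |c i - c₀ i| ≤ w i) → ∑ i, L v i * c i ∈ Icc (lo v) (hi v))
    (hcheck : m ≤ ∑ v ∈ S, φ v (∑ i, L v i * c₀ i)
        - ∑ i, |∑ v ∈ S, φ' v (∑ j, L v j * c₀ j) * L v i| * w i
        - 1 / 2 * ∑ v ∈ S, M v * (∑ i, |L v i| * w i) ^ 2)
    (c : Fin n → ℝ) (hbox : ∀ i, |c i - c₀ i| ≤ w i) :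
    m ≤ ∑ v ∈ S, φ v (∑ i, L v i * c i) := by
  have hcf := centredForm_le_sum S L φ φ' lo hi M c c₀ hr₀ (fun v hv => hrange v hv c hbox) hd hmono
  -- abbreviations
  set δ : ι → ℝ := fun v => ∑ i, L v i * c i - ∑ i, L v i * c₀ i with hδ
  set d : ι → ℝ := fun v => φ' v (∑ j, L v j * c₀ j) with hdφ
  -- (1) the linear part, regrouped by coordinates, is `≥ −∑ |gᵢ| wᵢ`
  have hlin_eq : ∑ v ∈ S, d v * δ v = ∑ i, (∑ v ∈ S, d v * L v i) * (c i - c₀ i) := by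
    have : ∀ v ∈ S, d v * δ v = ∑ i, d v * L v i * (c i - c₀ i) := by
      intro v _
      simp only [hδ, ← Finset.sum_sub_distrib, Finset.mul_sum]
      refine Finset.sum_congr rfl fun i _ => by ring
    rw [Finset.sum_congr rfl this, Finset.sum_comm]
    refine Finset.sum_congr rfl fun i _ => by rw [Finset.sum_mul]
  have hlin : -∑ i, |∑ v ∈ S, d v * L v i| * w i ≤ ∑ v ∈ S, d v * δ v := by
    rw [hlin_eq]; exact neg_sum_abs_mul_le_linear _ c c₀ w hbox
  -- (2) the quadratic part: `δᵥ² ≤ (∑ |Lᵥᵢ| wᵢ)²`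
  have hquad : ∑ v ∈ S, M v / 2 * δ v ^ 2 ≤ 1 / 2 * ∑ v ∈ S, M v * (∑ i, |L v i| * w i) ^ 2 := by
    rw [Finset.mul_sum]
    refine Finset.sum_le_sum fun v hv => ?_
    have hδle : |δ v| ≤ ∑ i, |L v i| * w i := abs_linear_sub_le (L v) c c₀ w hbox
    have hsq : δ v ^ 2 ≤ (∑ i, |L v i| * w i) ^ 2 := by
      have h0 : 0 ≤ ∑ i, |L v i| * w i := (abs_nonneg _).trans hδle
      calc δ v ^ 2 = |δ v| ^ 2 := (sq_abs _).symm
        _ ≤ (∑ i, |L v i| * w i) ^ 2 := pow_le_pow_left₀ (abs_nonneg _) hδle 2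
    have := mul_le_mul_of_nonneg_left hsq (hM v hv)
    linarith
  -- (3) assemble
  have hsplit : ∑ v ∈ S, (φ v (∑ i, L v i * c₀ i) + d v * δ v - M v / 2 * δ v ^ 2)
      = ∑ v ∈ S, φ v (∑ i, L v i * c₀ i) + ∑ v ∈ S, d v * δ v - ∑ v ∈ S, M v / 2 * δ v ^ 2 := by
    rw [← Finset.sum_add_distrib, ← Finset.sum_sub_distrib]
  have hcf' : ∑ v ∈ S, (φ v (∑ i, L v i * c₀ i) + d v * δ v - M v / 2 * δ v ^ 2)
      ≤ ∑ v ∈ S, φ v (∑ i, L v i * c i) := by simpa only [hδ, hdφ] using hcf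
  linarith [hcf', hsplit, hlin, hquad, hcheck]

/-- The box range of a linear functional: `ℓ c ∈ [ℓ c₀ − ∑ᵢ |Lᵢ| wᵢ, ℓ c₀ + ∑ᵢ |Lᵢ| wᵢ]` whenever `|cᵢ − c₀ᵢ| ≤ wᵢ`. [folklore] -/
theorem linear_mem_Icc_of_box {n : ℕ} (L c c₀ w : Fin n → ℝ) (hbox : ∀ i, |c i - c₀ i| ≤ w i) :
    ∑ i, L i * c i ∈ Icc (∑ i, L i * c₀ i - ∑ i, |L i| * w i) (∑ i, L i * c₀ i + ∑ i, |L i| * w i) := by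
  have h := abs_linear_sub_le L c c₀ w hbox
  rw [abs_le] at h
  constructor <;> linarith [h.1, h.2]

/-- **LEAF SOUNDNESS, self-ranging form** (the shape a reflected checker consumes): the term ranges are the explicit box ranges
`[ℓᵥ c₀ − rᵥ, ℓᵥ c₀ + rᵥ]`, `rᵥ = ∑ᵢ |Lᵥᵢ| wᵢ`; hypotheses are only (i) `wᵢ ≥ 0`, (ii) per term: `φᵥ` differentiable with `φᵥ′ + Mᵥ·id`
monotone on that range and `Mᵥ ≥ 0`, (iii) the checker's inequality.  Conclusion: `m ≤ ∑ᵥ φᵥ(ℓᵥ c)` on the whole box. [folklore] -/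
theorem leaf_sound_box {ι : Type*} (S : Finset ι) {n : ℕ} (L : ι → Fin n → ℝ) (φ φ' : ι → ℝ → ℝ) (M : ι → ℝ)
    (c₀ w : Fin n → ℝ) (m : ℝ) (hw : ∀ i, 0 ≤ w i) (hM : ∀ v ∈ S, 0 ≤ M v)
    (hd : ∀ v ∈ S, ∀ t ∈ Icc (∑ i, L v i * c₀ i - ∑ i, |L v i| * w i) (∑ i, L v i * c₀ i + ∑ i, |L v i| * w i),
      HasDerivAt (φ v) (φ' v t) t)
    (hmono : ∀ v ∈ S, MonotoneOn (fun t => φ' v t + M v * t)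
      (Icc (∑ i, L v i * c₀ i - ∑ i, |L v i| * w i) (∑ i, L v i * c₀ i + ∑ i, |L v i| * w i)))
    (hcheck : m ≤ ∑ v ∈ S, φ v (∑ i, L v i * c₀ i)
        - ∑ i, |∑ v ∈ S, φ' v (∑ j, L v j * c₀ j) * L v i| * w i
        - 1 / 2 * ∑ v ∈ S, M v * (∑ i, |L v i| * w i) ^ 2)
    (c : Fin n → ℝ) (hbox : ∀ i, |c i - c₀ i| ≤ w i) :
    m ≤ ∑ v ∈ S, φ v (∑ i, L v i * c i) := by
  refine leaf_sound S L φ φ' (fun v => ∑ i, L v i * c₀ i - ∑ i, |L v i| * w i)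
    (fun v => ∑ i, L v i * c₀ i + ∑ i, |L v i| * w i) M c₀ w m hM hd hmono (fun v _ => ?_)
    (fun v _ c' hc' => linear_mem_Icc_of_box (L v) c' c₀ w hc') hcheck c hbox
  have h0 : 0 ≤ ∑ i, |L v i| * w i := Finset.sum_nonneg fun i _ => mul_nonneg (abs_nonneg _) (hw i)
  exact ⟨by linarith, by linarith⟩

end Summit.AtomisticToContinuum.Crystallization.Theorems.FrustratedLawDichotomyStrainedPatchHomCentredForm
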